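import Literature.Analysis.FluidPDE.LoopCirculation
import Summits.NavierStokesRegularity.NavierStokesRegularity.Theorems.FilamentSkeletonRssTorqueFreePotential

/-!
# Route `FilamentSkeletonRss` · crux `SelectionBoxRJ` (stmt-NavierStokesRegularity-21220) — the multiplier ↔ wall-circulation
# DICTIONARY: the circulation of an accretion mode around a coaxial wall circle, and the circulation of the profile
# operator of any solution of the crux's forced profile equation

Lane `ns-filament-19175-p1` (g10).  Helper file `--supports stmt-NavierStokesRegularity-21220 --as helper`; route-independent
(no Theses import; the crux's shapes are written out verbatim).  Bears on the whole J selection layer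
(`SelectionBoxRJ` 21220 / `TransverseReductionRJ` 21221 / asides 19174–19175).

SOURCE OF THE STATEMENT.  F6 verdict memo of the crux-level line `rpi_window_split`
(`Cruxes/SelectionBoxRJ/Lines/rpi_window_split_v6_F6.md`, ns-idea-12 g2, 2026-08-28), §1(c), labelled EXACT:
«For an ADMISSIBLE triple the left side [of the torque budget on the disc `D_R(s)` of filament `j`] equals
`Σ_k B_k ∮_{∂D_R(s)} D_k·dl = 2πB_j e^{−s²}(1−e^{−R²}) + Σ_{k≠j} B_k τ_jk(s,R)` …  `∮∇P·dl = 0`.  So (TB) is an exact identity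
relating `B` to the circulation profile `C_R(s)` and the vorticity ON THE WALL `∂D_R(s)`.»

WHAT IS KERNEL-CHECKED HERE.
* `circulation_sum_smul` — the tree's `circulation` is linear over finite combinations of continuous fields;
* `circulation_eq_sum_of_profileEquation` — **the dictionary, abstract form**: if a field `E`, a `C¹` pressure `P`,
  multipliers `B` and continuous modes `D_k` satisfy `E y + ∇P y = Σ_k B_k • D_k y` at every point (the shape of the crux's
  forced profile equation, with `E = E_α(U)` written out there), then around every closed `C¹` loop
  `∮_γ E·dl = Σ_k B_k ∮_γ D_k·dl` (the pressure drops out by the gradient theorem of `…TorqueFreePotential`);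
* `circulation_accretionMode_circleLoop` — **the mode's wall circulation, closed form**: for the crux's accretion mode
  `D(y) = e^{−⟪y−X,t⟫²} (1 − e^{−(|y−X|² − ⟪y−X,t⟫²)})/(|y−X|² − ⟪y−X,t⟫²) • t × (y − X)` (clause `DefD` verbatim, `X` the
  stagnation point, `t` the unit tangent) and ANY orthonormal frame `![t, e₁, e₂]` (the crux's clause-15 frame
  `![X′(c), m, n]` is one), the circulation around the coaxial circle of radius `R` in the section at height `s`,
  `circleLoop (X + s•t) R e₁ e₂`, is `2π · e^{−s²}(1 − e^{−R²}) · ⟪t × e₁, e₂⟫` (`⟪t × e₁, e₂⟫ = ±1` is the orientation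
  of the frame) — the memo's `2πB_j e^{−s²}(1−e^{−R²})` per unit multiplier;
* `circulation_profileOp_wallCircle` — the two combined: `∮_{∂D_R(s)} E·dl = B_j · 2π e^{−s²}(1−e^{−R²})⟪t×e₁,e₂⟫ +
  Σ_{k ≠ j} B_k ∮_{∂D_R(s)} D_k·dl`.
Algebra used on the way (`cross_self_eq_zero`, frame bookkeeping `coaxialCircle_bookkeeping`) is proved inline.

HONEST FRAMING.  Exact elementary identities about the objects of a HYPOTHETICAL filament-type rotating Leray profile
construction (refutation-side bookkeeping); nothing here bears on Navier–Stokes regularity or blow-up, and no summit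
statement is proved by this file.
-/

set_option linter.dupNamespace false

noncomputable section

namespace Summit.NavierStokesRegularity.NavierStokesRegularity.Theorems

open Set Function Filter Real MeasureTheory
open Literature.Analysis.FluidPDE
open scoped InnerProductSpace Topology

namespace TorqueBudget

/-! ### Linearity of the circulation and the dictionary -/

/-- The circulation of a finite linear combination of continuous fields around a `C¹` curve is the same combination
of the circulations. [folklore] -/
theorem circulation_sum_smul {N : ℕ} {D : Fin N → EuclideanSpace ℝ (Fin 3) → EuclideanSpace ℝ (Fin 3)}
    (hD : ∀ k, Continuous (D k)) (B : Fin N → ℝ) {γ : ℝ → EuclideanSpace ℝ (Fin 3)} (hγ : ContDiff ℝ 1 γ) :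
    circulation (fun y => ∑ k, B k • D k y) γ = ∑ k, B k * circulation (D k) γ := by
  unfold circulation
  have hint : ∀ k, IntervalIntegrable (fun s => ⟪D k (γ s), deriv γ s⟫_ℝ) volume 0 1 := fun k =>
    intervalIntegrable_inner_deriv (hD k) hγ 0 1
  have h1 : (fun s => ⟪∑ k, B k • D k (γ s), deriv γ s⟫_ℝ) = fun s => ∑ k, B k * ⟪D k (γ s), deriv γ s⟫_ℝ := by
    funext s
    rw [sum_inner]
    refine Finset.sum_congr rfl fun k _ => ?_
    rw [real_inner_smul_left]
  rw [h1, intervalIntegral.integral_finsetSum (fun k _ => (hint k).const_mul (B k))]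
  refine Finset.sum_congr rfl fun k _ => ?_
  exact intervalIntegral.integral_const_mul (B k) _

/-- **The multiplier ↔ circulation dictionary** (F6 memo §1(c)).  If `E y + ∇P y = Σ_k B_k • D_k y` holds at every point
(the shape of the crux's forced profile equation `E_α(U_p) + ∇P_p = Σ_j B_pj D_pj`), with the modes continuous and
`P ∈ C¹` (continuity of `E` then follows), then around every closed `C¹` loop the pressure drops out and `∮_γ E·dl = Σ_k B_k ∮_γ D_k·dl`. [folklore] -/
theorem circulation_eq_sum_of_profileEquation {N : ℕ} {E : EuclideanSpace ℝ (Fin 3) → EuclideanSpace ℝ (Fin 3)}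
    {P : EuclideanSpace ℝ (Fin 3) → ℝ} {B : Fin N → ℝ} {D : Fin N → EuclideanSpace ℝ (Fin 3) → EuclideanSpace ℝ (Fin 3)}
    (hP : ContDiff ℝ 1 P) (hD : ∀ k, Continuous (D k))
    (heq : ∀ y, E y + gradient P y = ∑ k, B k • D k y)
    {γ : ℝ → EuclideanSpace ℝ (Fin 3)} (hγ : ContDiff ℝ 1 γ) (hloop : γ 0 = γ 1) :
    circulation E γ = ∑ k, B k * circulation (D k) γ := by
  have hsum : Continuous (fun y => ∑ k, B k • D k y) :=
    continuous_finsetSum _ (fun k _ => (hD k).const_smul (B k))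
  have hE' : E = (fun y => ∑ k, B k • D k y) - gradient P := by
    funext y
    simp only [Pi.sub_apply, ← heq y, add_sub_cancel_right]
  rw [hE', circulation_sub_left hsum (continuous_gradient_of_contDiff hP) hγ,
    circulation_gradient_loop_eq_zero hP hγ hloop, sub_zero, circulation_sum_smul hD B hγ]

/-! ### The accretion mode's wall circulation -/

/-- `a × a = 0`. [folklore] -/
theorem cross_self_eq_zero (a : EuclideanSpace ℝ (Fin 3)) : cross a a = 0 := by
  ext i
  fin_cases i <;> simp [cross, crossProduct] <;> ring

/-! (`⟪a × b, b⟫ = 0` is the landed `TransverseReductionRCensus.inner_cross_self_right` of the lineage's g0 census, a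
route-dependent module; it is re-derived inline below from `inner_cross_left_swap` to keep this file outside the theses cone.) -/

/-- Bookkeeping on a coaxial circle.  With `![t, e₁, e₂]` orthonormal and
`v = s•t + (R cos θ)•e₁ + (R sin θ)•e₂`: `⟪v, t⟫ = s`, `|v|² − ⟪v,t⟫² = R²`, and the swirl direction pairs with the
circle's velocity as `⟪t × v, −(R sin θ)•e₁ + (R cos θ)•e₂⟫ = R² ⟪t × e₁, e₂⟫`. [folklore] -/
theorem coaxialCircle_bookkeeping (t e₁ e₂ : EuclideanSpace ℝ (Fin 3)) (hon : Orthonormal ℝ ![t, e₁, e₂])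
    (s R θ : ℝ) :
    ⟪s • t + (R * cos θ) • e₁ + (R * sin θ) • e₂, t⟫_ℝ = s ∧
    ‖s • t + (R * cos θ) • e₁ + (R * sin θ) • e₂‖ ^ 2 - ⟪s • t + (R * cos θ) • e₁ + (R * sin θ) • e₂, t⟫_ℝ ^ 2 = R ^ 2 ∧
    ⟪cross t (s • t + (R * cos θ) • e₁ + (R * sin θ) • e₂), (-(R * sin θ)) • e₁ + (R * cos θ) • e₂⟫_ℝ
      = R ^ 2 * ⟪cross t e₁, e₂⟫_ℝ := by
  have h := orthonormal_iff_ite.mp hon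
  have htt : ⟪t, t⟫_ℝ = 1 := by simpa using h 0 0
  have h11 : ⟪e₁, e₁⟫_ℝ = 1 := by simpa using h 1 1
  have h22 : ⟪e₂, e₂⟫_ℝ = 1 := by simpa using h 2 2
  have h01 : ⟪t, e₁⟫_ℝ = 0 := by simpa using h 0 1
  have h02 : ⟪t, e₂⟫_ℝ = 0 := by simpa using h 0 2
  have h12 : ⟪e₁, e₂⟫_ℝ = 0 := by simpa using h 1 2
  have h10 : ⟪e₁, t⟫_ℝ = 0 := by rw [real_inner_comm]; exact h01
  have h20 : ⟪e₂, t⟫_ℝ = 0 := by rw [real_inner_comm]; exact h02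
  have h21 : ⟪e₂, e₁⟫_ℝ = 0 := by rw [real_inner_comm]; exact h12
  have hvt : ⟪s • t + (R * cos θ) • e₁ + (R * sin θ) • e₂, t⟫_ℝ = s := by
    simp only [inner_add_left, real_inner_smul_left, htt, h10, h20]
    ring
  refine ⟨hvt, ?_, ?_⟩
  · rw [hvt, ← real_inner_self_eq_norm_sq]
    simp only [inner_add_left, inner_add_right, real_inner_smul_left, real_inner_smul_right, htt, h11, h22, h01,
      h02, h12, h10, h20, h21]
    have hcs : cos θ ^ 2 + sin θ ^ 2 = 1 := cos_sq_add_sin_sq θ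
    nlinarith [hcs]
  · have hlin : cross t (s • t + (R * cos θ) • e₁ + (R * sin θ) • e₂)
        = (R * cos θ) • cross t e₁ + (R * sin θ) • cross t e₂ := by
      have e : ∀ v, cross t v = crossCLM t v := fun v => rfl
      rw [e, map_add, map_add, map_smul, map_smul, map_smul, ← e, ← e, ← e, cross_self_eq_zero, smul_zero, zero_add]
    rw [hlin]
    have hx11 : ⟪cross t e₁, e₁⟫_ℝ = 0 := by have h := inner_cross_left_swap t e₁ e₁; linarith
    have hx22 : ⟪cross t e₂, e₂⟫_ℝ = 0 := by have h := inner_cross_left_swap t e₂ e₂; linarith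
    have hx21 : ⟪cross t e₂, e₁⟫_ℝ = -⟪cross t e₁, e₂⟫_ℝ := inner_cross_left_swap t e₂ e₁
    simp only [inner_add_left, inner_add_right, real_inner_smul_left, real_inner_smul_right, hx11, hx22, hx21]
    have hcs : cos θ ^ 2 + sin θ ^ 2 = 1 := cos_sq_add_sin_sq θ
    linear_combination (R ^ 2 * ⟪cross t e₁, e₂⟫_ℝ) * hcs

/-- **The accretion mode's wall circulation in closed form** (F6 memo §1(c): `∮_{∂D_R(s)} D_j·dl = 2π e^{−s²}(1−e^{−R²})`
per unit multiplier).  For the crux's mode shape (clause `DefD` verbatim, about the stagnation point `X` with unit tangent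
`t`) and any orthonormal frame `![t, e₁, e₂]`, the circulation around the coaxial circle of radius `R` at height `s` is
`2π · e^{−s²}(1 − e^{−R²}) · ⟪t × e₁, e₂⟫` (the last factor, `±1`, is the orientation of the frame; no sign condition on
`R`, and both sides vanish at `R = 0`). [folklore] -/
theorem circulation_accretionMode_circleLoop (X t e₁ e₂ : EuclideanSpace ℝ (Fin 3)) (hon : Orthonormal ℝ ![t, e₁, e₂])
    {D : EuclideanSpace ℝ (Fin 3) → EuclideanSpace ℝ (Fin 3)}
    (hD : ∀ y, D y = (Real.exp (-(⟪y - X, t⟫_ℝ) ^ 2) * ((1 - Real.exp (-(‖y - X‖ ^ 2 - ⟪y - X, t⟫_ℝ ^ 2)))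
      / (‖y - X‖ ^ 2 - ⟪y - X, t⟫_ℝ ^ 2))) • cross t (y - X)) (s R : ℝ) :
    circulation D (circleLoop (X + s • t) R e₁ e₂)
      = 2 * π * (Real.exp (-s ^ 2) * (1 - Real.exp (-R ^ 2))) * ⟪cross t e₁, e₂⟫_ℝ := by
  rw [circulation_circleLoop]
  have hI : (fun θ => ⟪D (X + s • t + (R * cos θ) • e₁ + (R * sin θ) • e₂), (-(R * sin θ)) • e₁ + (R * cos θ) • e₂⟫_ℝ)
      = fun _ => (Real.exp (-s ^ 2) * (1 - Real.exp (-R ^ 2))) * ⟪cross t e₁, e₂⟫_ℝ := by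
    funext θ
    have hv : X + s • t + (R * cos θ) • e₁ + (R * sin θ) • e₂ - X = s • t + (R * cos θ) • e₁ + (R * sin θ) • e₂ := by
      abel
    obtain ⟨h1, h2, h3⟩ := coaxialCircle_bookkeeping t e₁ e₂ hon s R θ
    rw [hD, hv, real_inner_smul_left, h3, h2, h1]
    rcases eq_or_ne R 0 with hR | hR
    · subst hR; simp
    · field_simp
  rw [hI, intervalIntegral.integral_const, smul_eq_mul]
  ring

/-- **Dictionary on the wall circle of filament `j`** (F6 memo §1(c), the right side of (TB)): for `E`, `P ∈ C¹`, `B`,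
continuous modes `D_k` with `E + ∇P = Σ_k B_k D_k` pointwise, and `D_j` of the crux's shape about `(X, t)` with an
orthonormal frame `![t, e₁, e₂]`,
`∮_{∂D_R(s)} E·dl = B_j · 2π e^{−s²}(1−e^{−R²}) ⟪t×e₁, e₂⟫ + Σ_{k ≠ j} B_k ∮_{∂D_R(s)} D_k·dl`. [folklore] -/
theorem circulation_profileOp_wallCircle {N : ℕ} {E : EuclideanSpace ℝ (Fin 3) → EuclideanSpace ℝ (Fin 3)}
    {P : EuclideanSpace ℝ (Fin 3) → ℝ} {B : Fin N → ℝ} {D : Fin N → EuclideanSpace ℝ (Fin 3) → EuclideanSpace ℝ (Fin 3)}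
    (hP : ContDiff ℝ 1 P) (hD : ∀ k, Continuous (D k))
    (heq : ∀ y, E y + gradient P y = ∑ k, B k • D k y)
    (j : Fin N) (X t e₁ e₂ : EuclideanSpace ℝ (Fin 3)) (hon : Orthonormal ℝ ![t, e₁, e₂])
    (hDj : ∀ y, D j y = (Real.exp (-(⟪y - X, t⟫_ℝ) ^ 2) * ((1 - Real.exp (-(‖y - X‖ ^ 2 - ⟪y - X, t⟫_ℝ ^ 2)))
      / (‖y - X‖ ^ 2 - ⟪y - X, t⟫_ℝ ^ 2))) • cross t (y - X)) (s R : ℝ) :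
    circulation E (circleLoop (X + s • t) R e₁ e₂)
      = B j * (2 * π * (Real.exp (-s ^ 2) * (1 - Real.exp (-R ^ 2))) * ⟪cross t e₁, e₂⟫_ℝ)
        + ∑ k ∈ Finset.univ.erase j, B k * circulation (D k) (circleLoop (X + s • t) R e₁ e₂) := by
  rw [circulation_eq_sum_of_profileEquation hP hD heq (contDiff_circleLoop _ R e₁ e₂)
      (isC1Loop_circleLoop _ R e₁ e₂).apply_zero_eq_apply_one,
    ← Finset.add_sum_erase _ _ (Finset.mem_univ j), circulation_accretionMode_circleLoop X t e₁ e₂ hon hDj s R]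

end TorqueBudget

end Summit.NavierStokesRegularity.NavierStokesRegularity.Theorems
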